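import Mathlib
import Literature.NumberTheory.Irrationality.BrownZudilin2022.GeneralFamily
import Literature.NumberTheory.Irrationality.BrownZudilin2022.CubicalForm
import Literature.NumberTheory.Irrationality.BrownZudilin2022.BarnesRepresentation
import Summits.KontsevichZagierPeriods.Zeta5Search.WedgeDictionaryThreeTerm
import Summits.KontsevichZagierPeriods.Zeta5Search.WedgeDictionaryKernelTransport

/-!
# (H1)-free cellular relations by TRANSPORT, part B2: factorial shift lemmas for `slotDown 5`, `slotDown 6`, `slotDown 7`, `dsUp` (cell `pub-zeta5`, lineage gen-1, g21)

HONEST FRAMING: systematic search; no irrationality claim unless certified.  Structure of gen-1's period dictionary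
(`WedgeDictionary.explicitPQ`, an OPEN conjecture node) only; nothing about linear forms or ζ(5); nothing is evaluated.

OUR work (Summit side); no hypotheses beyond convergence.  For each of the eight difference vectors `v` of the cells (`slotDown k`,
`k = 1..7`, and `dsUp`): the F-forms `h_i`, `i ∈ F`, change under `a ↦ a + v` by `c_i ∈ {−1,0,1}`; with `shiftD_v a = ∏_{c_i=−1} h_i(a)` and
`shiftU_v a = ∏_{c_i=+1} (h_i(a)+1)` (integers), `prodF (a + v) · shiftD_v a = prodF a · shiftU_v a` whenever `a` and `a + v` converge
(`prodF_<v>`), and both shift factors are then positive (`shiftD_<v>_pos`, `shiftU_<v>_pos`).  Pure factorial bookkeeping.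
-/

set_option maxHeartbeats 8000000
set_option linter.unusedSimpArgs false
set_option linter.unusedTactic false
set_option linter.unreachableTactic false
set_option linter.unnecessarySeqFocus false
set_option linter.style.longLine false
set_option linter.unusedVariables false

namespace Summit.KontsevichZagierPeriods.Zeta5Search.WedgeDictionary.KernelCells

open Literature.NumberTheory.Irrationality.BrownZudilin2022 MeasureTheory

/-- `∏ h_i(a)` over the F-forms that DROP by one under `a ↦ a + slotDown 5` (forms none). -/
def shiftD5 (a : Fin 8 → ℤ) : ℤ := 1
/-- `∏ (h_i(a)+1)` over the F-forms that RISE by one under `a ↦ a + slotDown 5` (forms [6, 18, 11, 27]). -/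
def shiftU5 (a : Fin 8 → ℤ) : ℤ := (hForm a 6 + 1) * (hForm a 18 + 1) * (hForm a 11 + 1) * (hForm a 27 + 1)

/-- Factorial shift under `a ↦ a + slotDown 5`: `prodF (a + v)·shiftD = prodF a·shiftU` for `a`, `a + v` convergent. -/
theorem prodF_slotDown5 (a : Fin 8 → ℤ) (h0 : Converges a) (h1 : Converges (a + slotDown 5)) :
    prodF (a + slotDown 5) * (shiftD5 a : ℝ) = prodF a * (shiftU5 a : ℝ) := by
  have e1 : hForm (a + slotDown 5) 1 = hForm a 1 := by simp [hForm, hList, slotDown, dsUp]; try ring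
  have e2 : hForm (a + slotDown 5) 2 = hForm a 2 := by simp [hForm, hList, slotDown, dsUp]; try ring
  have e3 : hForm (a + slotDown 5) 3 = hForm a 3 := by simp [hForm, hList, slotDown, dsUp]; try ring
  have e4 : hForm (a + slotDown 5) 4 = hForm a 4 := by simp [hForm, hList, slotDown, dsUp]; try ring
  have e5 : hForm (a + slotDown 5) 5 = hForm a 5 := by simp [hForm, hList, slotDown, dsUp]; try ring
  have e6 : hForm (a + slotDown 5) 6 = hForm a 6 + 1 := by simp [hForm, hList, slotDown, dsUp]; try ring
  have e7 : hForm (a + slotDown 5) 7 = hForm a 7 := by simp [hForm, hList, slotDown, dsUp]; try ring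
  have e10 : hForm (a + slotDown 5) 10 = hForm a 10 := by simp [hForm, hList, slotDown, dsUp]; try ring
  have e14 : hForm (a + slotDown 5) 14 = hForm a 14 := by simp [hForm, hList, slotDown, dsUp]; try ring
  have e28 : hForm (a + slotDown 5) 28 = hForm a 28 := by simp [hForm, hList, slotDown, dsUp]; try ring
  have e20 : hForm (a + slotDown 5) 20 = hForm a 20 := by simp [hForm, hList, slotDown, dsUp]; try ring
  have e18 : hForm (a + slotDown 5) 18 = hForm a 18 + 1 := by simp [hForm, hList, slotDown, dsUp]; try ring
  have e23 : hForm (a + slotDown 5) 23 = hForm a 23 := by simp [hForm, hList, slotDown, dsUp]; try ring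
  have e11 : hForm (a + slotDown 5) 11 = hForm a 11 + 1 := by simp [hForm, hList, slotDown, dsUp]; try ring
  have e9 : hForm (a + slotDown 5) 9 = hForm a 9 := by simp [hForm, hList, slotDown, dsUp]; try ring
  have e16 : hForm (a + slotDown 5) 16 = hForm a 16 := by simp [hForm, hList, slotDown, dsUp]; try ring
  have e27 : hForm (a + slotDown 5) 27 = hForm a 27 + 1 := by simp [hForm, hList, slotDown, dsUp]; try ring
  have g6 : 0 ≤ hForm a 6 := hForm_nonneg h0 6 (by decide)
  have g18 : 0 ≤ hForm a 18 := hForm_nonneg h0 18 (by decide)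
  have g11 : 0 ≤ hForm a 11 := hForm_nonneg h0 11 (by decide)
  have g27 : 0 ≤ hForm a 27 := hForm_nonneg h0 27 (by decide)
  rw [prodF_unfold, prodF_unfold, e1, e2, e3, e4, e5, e6, e7, e10, e14, e28, e20, e18, e23, e11, e9, e16, e27]
  rw [fact_split (hForm a 6 + 1) (by omega), fact_split (hForm a 18 + 1) (by omega), fact_split (hForm a 11 + 1) (by omega), fact_split (hForm a 27 + 1) (by omega)]
  simp only [add_sub_cancel_right]
  simp only [shiftD5, shiftU5]; push_cast; ring

/-- Positivity of `shiftD` under convergence of `a + slotDown 5`. -/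
theorem shiftD5_pos (a : Fin 8 → ℤ) (h1 : Converges (a + slotDown 5)) : (0 : ℝ) < (shiftD5 a : ℝ) := by
  simp only [shiftD5]; push_cast; positivity

/-- Positivity of `shiftU` under convergence of `a`. -/
theorem shiftU5_pos (a : Fin 8 → ℤ) (h0 : Converges a) : (0 : ℝ) < (shiftU5 a : ℝ) := by
  have g6 : (0 : ℝ) ≤ (hForm a 6 : ℝ) := by exact_mod_cast hForm_nonneg h0 6 (by decide)
  have g18 : (0 : ℝ) ≤ (hForm a 18 : ℝ) := by exact_mod_cast hForm_nonneg h0 18 (by decide)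
  have g11 : (0 : ℝ) ≤ (hForm a 11 : ℝ) := by exact_mod_cast hForm_nonneg h0 11 (by decide)
  have g27 : (0 : ℝ) ≤ (hForm a 27 : ℝ) := by exact_mod_cast hForm_nonneg h0 27 (by decide)
  simp only [shiftU5]; push_cast; positivity

/-- `∏ h_i(a)` over the F-forms that DROP by one under `a ↦ a + slotDown 6` (forms none). -/
def shiftD6 (a : Fin 8 → ℤ) : ℤ := 1
/-- `∏ (h_i(a)+1)` over the F-forms that RISE by one under `a ↦ a + slotDown 6` (forms [6, 7, 14, 23]). -/
def shiftU6 (a : Fin 8 → ℤ) : ℤ := (hForm a 6 + 1) * (hForm a 7 + 1) * (hForm a 14 + 1) * (hForm a 23 + 1)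

/-- Factorial shift under `a ↦ a + slotDown 6`: `prodF (a + v)·shiftD = prodF a·shiftU` for `a`, `a + v` convergent. -/
theorem prodF_slotDown6 (a : Fin 8 → ℤ) (h0 : Converges a) (h1 : Converges (a + slotDown 6)) :
    prodF (a + slotDown 6) * (shiftD6 a : ℝ) = prodF a * (shiftU6 a : ℝ) := by
  have e1 : hForm (a + slotDown 6) 1 = hForm a 1 := by simp [hForm, hList, slotDown, dsUp]; try ring
  have e2 : hForm (a + slotDown 6) 2 = hForm a 2 := by simp [hForm, hList, slotDown, dsUp]; try ring
  have e3 : hForm (a + slotDown 6) 3 = hForm a 3 := by simp [hForm, hList, slotDown, dsUp]; try ring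
  have e4 : hForm (a + slotDown 6) 4 = hForm a 4 := by simp [hForm, hList, slotDown, dsUp]; try ring
  have e5 : hForm (a + slotDown 6) 5 = hForm a 5 := by simp [hForm, hList, slotDown, dsUp]; try ring
  have e6 : hForm (a + slotDown 6) 6 = hForm a 6 + 1 := by simp [hForm, hList, slotDown, dsUp]; try ring
  have e7 : hForm (a + slotDown 6) 7 = hForm a 7 + 1 := by simp [hForm, hList, slotDown, dsUp]; try ring
  have e10 : hForm (a + slotDown 6) 10 = hForm a 10 := by simp [hForm, hList, slotDown, dsUp]; try ring
  have e14 : hForm (a + slotDown 6) 14 = hForm a 14 + 1 := by simp [hForm, hList, slotDown, dsUp]; try ring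
  have e28 : hForm (a + slotDown 6) 28 = hForm a 28 := by simp [hForm, hList, slotDown, dsUp]; try ring
  have e20 : hForm (a + slotDown 6) 20 = hForm a 20 := by simp [hForm, hList, slotDown, dsUp]; try ring
  have e18 : hForm (a + slotDown 6) 18 = hForm a 18 := by simp [hForm, hList, slotDown, dsUp]; try ring
  have e23 : hForm (a + slotDown 6) 23 = hForm a 23 + 1 := by simp [hForm, hList, slotDown, dsUp]; try ring
  have e11 : hForm (a + slotDown 6) 11 = hForm a 11 := by simp [hForm, hList, slotDown, dsUp]; try ring
  have e9 : hForm (a + slotDown 6) 9 = hForm a 9 := by simp [hForm, hList, slotDown, dsUp]; try ring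
  have e16 : hForm (a + slotDown 6) 16 = hForm a 16 := by simp [hForm, hList, slotDown, dsUp]; try ring
  have e27 : hForm (a + slotDown 6) 27 = hForm a 27 := by simp [hForm, hList, slotDown, dsUp]; try ring
  have g6 : 0 ≤ hForm a 6 := hForm_nonneg h0 6 (by decide)
  have g7 : 0 ≤ hForm a 7 := hForm_nonneg h0 7 (by decide)
  have g14 : 0 ≤ hForm a 14 := hForm_nonneg h0 14 (by decide)
  have g23 : 0 ≤ hForm a 23 := hForm_nonneg h0 23 (by decide)
  rw [prodF_unfold, prodF_unfold, e1, e2, e3, e4, e5, e6, e7, e10, e14, e28, e20, e18, e23, e11, e9, e16, e27]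
  rw [fact_split (hForm a 6 + 1) (by omega), fact_split (hForm a 7 + 1) (by omega), fact_split (hForm a 14 + 1) (by omega), fact_split (hForm a 23 + 1) (by omega)]
  simp only [add_sub_cancel_right]
  simp only [shiftD6, shiftU6]; push_cast; ring

/-- Positivity of `shiftD` under convergence of `a + slotDown 6`. -/
theorem shiftD6_pos (a : Fin 8 → ℤ) (h1 : Converges (a + slotDown 6)) : (0 : ℝ) < (shiftD6 a : ℝ) := by
  simp only [shiftD6]; push_cast; positivity

/-- Positivity of `shiftU` under convergence of `a`. -/
theorem shiftU6_pos (a : Fin 8 → ℤ) (h0 : Converges a) : (0 : ℝ) < (shiftU6 a : ℝ) := by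
  have g6 : (0 : ℝ) ≤ (hForm a 6 : ℝ) := by exact_mod_cast hForm_nonneg h0 6 (by decide)
  have g7 : (0 : ℝ) ≤ (hForm a 7 : ℝ) := by exact_mod_cast hForm_nonneg h0 7 (by decide)
  have g14 : (0 : ℝ) ≤ (hForm a 14 : ℝ) := by exact_mod_cast hForm_nonneg h0 14 (by decide)
  have g23 : (0 : ℝ) ≤ (hForm a 23 : ℝ) := by exact_mod_cast hForm_nonneg h0 23 (by decide)
  simp only [shiftU6]; push_cast; positivity

/-- `∏ h_i(a)` over the F-forms that DROP by one under `a ↦ a + slotDown 7` (forms none). -/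
def shiftD7 (a : Fin 8 → ℤ) : ℤ := 1
/-- `∏ (h_i(a)+1)` over the F-forms that RISE by one under `a ↦ a + slotDown 7` (forms [7, 28, 20, 27]). -/
def shiftU7 (a : Fin 8 → ℤ) : ℤ := (hForm a 7 + 1) * (hForm a 28 + 1) * (hForm a 20 + 1) * (hForm a 27 + 1)

/-- Factorial shift under `a ↦ a + slotDown 7`: `prodF (a + v)·shiftD = prodF a·shiftU` for `a`, `a + v` convergent. -/
theorem prodF_slotDown7 (a : Fin 8 → ℤ) (h0 : Converges a) (h1 : Converges (a + slotDown 7)) :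
    prodF (a + slotDown 7) * (shiftD7 a : ℝ) = prodF a * (shiftU7 a : ℝ) := by
  have e1 : hForm (a + slotDown 7) 1 = hForm a 1 := by simp [hForm, hList, slotDown, dsUp]; try ring
  have e2 : hForm (a + slotDown 7) 2 = hForm a 2 := by simp [hForm, hList, slotDown, dsUp]; try ring
  have e3 : hForm (a + slotDown 7) 3 = hForm a 3 := by simp [hForm, hList, slotDown, dsUp]; try ring
  have e4 : hForm (a + slotDown 7) 4 = hForm a 4 := by simp [hForm, hList, slotDown, dsUp]; try ring
  have e5 : hForm (a + slotDown 7) 5 = hForm a 5 := by simp [hForm, hList, slotDown, dsUp]; try ring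
  have e6 : hForm (a + slotDown 7) 6 = hForm a 6 := by simp [hForm, hList, slotDown, dsUp]; try ring
  have e7 : hForm (a + slotDown 7) 7 = hForm a 7 + 1 := by simp [hForm, hList, slotDown, dsUp]; try ring
  have e10 : hForm (a + slotDown 7) 10 = hForm a 10 := by simp [hForm, hList, slotDown, dsUp]; try ring
  have e14 : hForm (a + slotDown 7) 14 = hForm a 14 := by simp [hForm, hList, slotDown, dsUp]; try ring
  have e28 : hForm (a + slotDown 7) 28 = hForm a 28 + 1 := by simp [hForm, hList, slotDown, dsUp]; try ring
  have e20 : hForm (a + slotDown 7) 20 = hForm a 20 + 1 := by simp [hForm, hList, slotDown, dsUp]; try ring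
  have e18 : hForm (a + slotDown 7) 18 = hForm a 18 := by simp [hForm, hList, slotDown, dsUp]; try ring
  have e23 : hForm (a + slotDown 7) 23 = hForm a 23 := by simp [hForm, hList, slotDown, dsUp]; try ring
  have e11 : hForm (a + slotDown 7) 11 = hForm a 11 := by simp [hForm, hList, slotDown, dsUp]; try ring
  have e9 : hForm (a + slotDown 7) 9 = hForm a 9 := by simp [hForm, hList, slotDown, dsUp]; try ring
  have e16 : hForm (a + slotDown 7) 16 = hForm a 16 := by simp [hForm, hList, slotDown, dsUp]; try ring
  have e27 : hForm (a + slotDown 7) 27 = hForm a 27 + 1 := by simp [hForm, hList, slotDown, dsUp]; try ring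
  have g7 : 0 ≤ hForm a 7 := hForm_nonneg h0 7 (by decide)
  have g28 : 0 ≤ hForm a 28 := hForm_nonneg h0 28 (by decide)
  have g20 : 0 ≤ hForm a 20 := hForm_nonneg h0 20 (by decide)
  have g27 : 0 ≤ hForm a 27 := hForm_nonneg h0 27 (by decide)
  rw [prodF_unfold, prodF_unfold, e1, e2, e3, e4, e5, e6, e7, e10, e14, e28, e20, e18, e23, e11, e9, e16, e27]
  rw [fact_split (hForm a 7 + 1) (by omega), fact_split (hForm a 28 + 1) (by omega), fact_split (hForm a 20 + 1) (by omega), fact_split (hForm a 27 + 1) (by omega)]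
  simp only [add_sub_cancel_right]
  simp only [shiftD7, shiftU7]; push_cast; ring

/-- Positivity of `shiftD` under convergence of `a + slotDown 7`. -/
theorem shiftD7_pos (a : Fin 8 → ℤ) (h1 : Converges (a + slotDown 7)) : (0 : ℝ) < (shiftD7 a : ℝ) := by
  simp only [shiftD7]; push_cast; positivity

/-- Positivity of `shiftU` under convergence of `a`. -/
theorem shiftU7_pos (a : Fin 8 → ℤ) (h0 : Converges a) : (0 : ℝ) < (shiftU7 a : ℝ) := by
  have g7 : (0 : ℝ) ≤ (hForm a 7 : ℝ) := by exact_mod_cast hForm_nonneg h0 7 (by decide)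
  have g28 : (0 : ℝ) ≤ (hForm a 28 : ℝ) := by exact_mod_cast hForm_nonneg h0 28 (by decide)
  have g20 : (0 : ℝ) ≤ (hForm a 20 : ℝ) := by exact_mod_cast hForm_nonneg h0 20 (by decide)
  have g27 : (0 : ℝ) ≤ (hForm a 27 : ℝ) := by exact_mod_cast hForm_nonneg h0 27 (by decide)
  simp only [shiftU7]; push_cast; positivity

/-- `∏ h_i(a)` over the F-forms that DROP by one under `a ↦ a + dsUp` (forms none). -/
def shiftDd (a : Fin 8 → ℤ) : ℤ := 1
/-- `∏ (h_i(a)+1)` over the F-forms that RISE by one under `a ↦ a + dsUp` (forms [2, 4]). -/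
def shiftUd (a : Fin 8 → ℤ) : ℤ := (hForm a 2 + 1) * (hForm a 4 + 1)

/-- Factorial shift under `a ↦ a + dsUp`: `prodF (a + v)·shiftD = prodF a·shiftU` for `a`, `a + v` convergent. -/
theorem prodF_dsUp (a : Fin 8 → ℤ) (h0 : Converges a) (h1 : Converges (a + dsUp)) :
    prodF (a + dsUp) * (shiftDd a : ℝ) = prodF a * (shiftUd a : ℝ) := by
  have e1 : hForm (a + dsUp) 1 = hForm a 1 := by simp [hForm, hList, slotDown, dsUp]; try ring
  have e2 : hForm (a + dsUp) 2 = hForm a 2 + 1 := by simp [hForm, hList, slotDown, dsUp]; try ring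
  have e3 : hForm (a + dsUp) 3 = hForm a 3 := by simp [hForm, hList, slotDown, dsUp]; try ring
  have e4 : hForm (a + dsUp) 4 = hForm a 4 + 1 := by simp [hForm, hList, slotDown, dsUp]; try ring
  have e5 : hForm (a + dsUp) 5 = hForm a 5 := by simp [hForm, hList, slotDown, dsUp]; try ring
  have e6 : hForm (a + dsUp) 6 = hForm a 6 := by simp [hForm, hList, slotDown, dsUp]; try ring
  have e7 : hForm (a + dsUp) 7 = hForm a 7 := by simp [hForm, hList, slotDown, dsUp]; try ring
  have e10 : hForm (a + dsUp) 10 = hForm a 10 := by simp [hForm, hList, slotDown, dsUp]; try ring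
  have e14 : hForm (a + dsUp) 14 = hForm a 14 := by simp [hForm, hList, slotDown, dsUp]; try ring
  have e28 : hForm (a + dsUp) 28 = hForm a 28 := by simp [hForm, hList, slotDown, dsUp]; try ring
  have e20 : hForm (a + dsUp) 20 = hForm a 20 := by simp [hForm, hList, slotDown, dsUp]; try ring
  have e18 : hForm (a + dsUp) 18 = hForm a 18 := by simp [hForm, hList, slotDown, dsUp]; try ring
  have e23 : hForm (a + dsUp) 23 = hForm a 23 := by simp [hForm, hList, slotDown, dsUp]; try ring
  have e11 : hForm (a + dsUp) 11 = hForm a 11 := by simp [hForm, hList, slotDown, dsUp]; try ring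
  have e9 : hForm (a + dsUp) 9 = hForm a 9 := by simp [hForm, hList, slotDown, dsUp]; try ring
  have e16 : hForm (a + dsUp) 16 = hForm a 16 := by simp [hForm, hList, slotDown, dsUp]; try ring
  have e27 : hForm (a + dsUp) 27 = hForm a 27 := by simp [hForm, hList, slotDown, dsUp]; try ring
  have g2 : 0 ≤ hForm a 2 := hForm_nonneg h0 2 (by decide)
  have g4 : 0 ≤ hForm a 4 := hForm_nonneg h0 4 (by decide)
  rw [prodF_unfold, prodF_unfold, e1, e2, e3, e4, e5, e6, e7, e10, e14, e28, e20, e18, e23, e11, e9, e16, e27]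
  rw [fact_split (hForm a 2 + 1) (by omega), fact_split (hForm a 4 + 1) (by omega)]
  simp only [add_sub_cancel_right]
  simp only [shiftDd, shiftUd]; push_cast; ring

/-- Positivity of `shiftD` under convergence of `a + dsUp`. -/
theorem shiftDd_pos (a : Fin 8 → ℤ) (h1 : Converges (a + dsUp)) : (0 : ℝ) < (shiftDd a : ℝ) := by
  simp only [shiftDd]; push_cast; positivity

/-- Positivity of `shiftU` under convergence of `a`. -/
theorem shiftUd_pos (a : Fin 8 → ℤ) (h0 : Converges a) : (0 : ℝ) < (shiftUd a : ℝ) := by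
  have g2 : (0 : ℝ) ≤ (hForm a 2 : ℝ) := by exact_mod_cast hForm_nonneg h0 2 (by decide)
  have g4 : (0 : ℝ) ≤ (hForm a 4 : ℝ) := by exact_mod_cast hForm_nonneg h0 4 (by decide)
  simp only [shiftUd]; push_cast; positivity

end Summit.KontsevichZagierPeriods.Zeta5Search.WedgeDictionary.KernelCells
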